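import Summits.CriticalPhenomena.SAWScalingLimit.Theorems.AnnularMassDecay.Negative.HalfPlaneDivergence
import Literature.Probability.Percolation.DualContours

/-!
# `AnnularMassDecay` (crux stmt-CriticalPhenomena-4729): the inner-avoidance clause is load-bearing

Standing disprover (cdisprove), cycle 2.  The crux asks that the interior vertices of the counted
walks lie in the OPEN ANNULUS `r < |· - z| < R`.  Here we drop the inner half of that clause (the
interior may enter the target disc `|· - z| ≤ r`; only the outer confinement `|· - z| < R` and the
endpoint clause are kept) and prove the resulting statement FALSE:

* `annMassNoAvoid_ge` — at `z = 0`, `R = m`, `r = m - 1`, `u = (m, 0)` every half-plane walk of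
  length `k ≤ K` (`K² ≤ m`), reflected and hung below the first inward step `(m,0) → (m-1,0)`, is
  counted by the variant, so the variant's mass is `≥ x_c · H_K` (`H_K` the half-plane partial sum of
  `HalfPlaneDivergence.lean`), while the claimed bound is `≤ C`;
* `annularMassDecay_false_without_avoidInner` — hence the variant is false, by
  `halfPlanePartialSum_unbounded`.

Moral for provers: without "the interior avoids the target disc" the family is no longer
prefix-free / bridge-like and inherits the divergence `H(x_c) = ∞`; any proof of the crux must use
the first-entrance structure of the endpoint. [folklore]
-/

namespace Summit.CriticalPhenomena.SAWScalingLimit.Theorems.AnnularMassDecay.Negative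

open Literature.Probability.RandomPlanarGeometry Literature.Probability.LatticeModels Filter Topology
open scoped BigOperators Classical
open Literature.Probability.Percolation.Contour (site_ext)

noncomputable section

/-! ### The variant without inner avoidance -/

/-- The crux's double sum with the INNER half of the annulus clause dropped: interior vertices are
only required to lie in the open outer disc `|· - z| < R` (they may enter the target disc). -/
def annMassNoAvoid (z : ℂ) (r R : ℝ) (u : Site 2) (N : ℕ) : ℝ :=
  ∑ n ∈ Finset.range (N + 1), ∑ _ω ∈ (SAW.Zd.saws 2 n).filter (fun ω =>
    (∀ i, 0 < i → i < n → dist (Site.toComplex (u + ω i)) z < R) ∧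
      dist (Site.toComplex (u + ω n)) z ≤ r), SAW.criticalFugacity ^ n

/-- The crux with the inner-avoidance clause `r < dist (u + ω i) z` DROPPED. -/
def WithoutAvoidInner : Prop :=
  ∃ θ C : ℝ, 0 < θ ∧ ∀ (z : ℂ) (r R : ℝ), 1 ≤ r → r < R → ∀ u : Site 2,
    R ≤ dist (Site.toComplex u) z → ∀ N : ℕ, annMassNoAvoid z r R u N ≤ C * (r / R) ^ θ

/-- The walk `ω` reflected in the first coordinate and hung below one step `0 → (-1, 0)`:
`hang ω 0 = 0`, `hang ω (j+1) = (-1 - ω_j⁰, ω_j¹)`. -/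
def hang (ω : ℕ → Site 2) (i : ℕ) : Site 2 :=
  if i = 0 then 0 else ![-1 - ω (i - 1) 0, ω (i - 1) 1]

/-- `hang ω` starts at the origin. [folklore] -/
@[simp] theorem hang_zero (ω : ℕ → Site 2) : hang ω 0 = 0 := by simp [hang]

/-- `hang ω (j+1) = (-1 - ω_j⁰, ω_j¹)`. [folklore] -/
theorem hang_succ (ω : ℕ → Site 2) (j : ℕ) : hang ω (j + 1) = ![-1 - ω j 0, ω j 1] := by
  simp [hang]

/-- First coordinate of `hang ω (j+1)`. [folklore] -/
theorem hang_succ_apply_zero (ω : ℕ → Site 2) (j : ℕ) : hang ω (j + 1) 0 = -1 - ω j 0 := by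
  simp [hang_succ]

/-- Second coordinate of `hang ω (j+1)`. [folklore] -/
theorem hang_succ_apply_one (ω : ℕ → Site 2) (j : ℕ) : hang ω (j + 1) 1 = ω j 1 := by
  simp [hang_succ]

/-- `hang` is injective. [folklore] -/
theorem hang_injective : Function.Injective hang := by
  intro ω ω' h
  funext j
  have h0 := congrFun (congrFun h (j + 1)) 0
  have h1 := congrFun (congrFun h (j + 1)) 1
  simp only [hang_succ_apply_zero, hang_succ_apply_one] at h0 h1
  funext t
  fin_cases t
  · show ω j 0 = ω' j 0
    linarith
  · exact h1

/-- For a half-space walk `ω` of length `k`, `hang ω` is a self-avoiding walk of length `k + 1`.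
[folklore] -/
theorem hang_mem_saws {k : ℕ} {ω : ℕ → Site 2} (hω : ω ∈ SAW.Zd.halfSpaceWalks 2 k) :
    hang ω ∈ SAW.Zd.saws 2 (k + 1) := by
  rw [SAW.Zd.mem_halfSpaceWalks] at hω
  obtain ⟨hsaw, hhalf⟩ := hω
  obtain ⟨h0, hend, hadj, hinj⟩ := SAW.Zd.mem_saws.1 hsaw
  have h00 : ω 0 0 = 0 := by rw [h0]; rfl
  -- first coordinates are nonnegative
  have hnn : ∀ j, 0 ≤ ω j 0 := by
    intro j
    rcases Nat.eq_zero_or_pos j with rfl | hj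
    · rw [h00]
    · rcases le_or_gt j k with hjk | hjk
      · have := hhalf j hj hjk; rw [h00] at this; exact this.le
      · rw [hend j hjk.le]
        rcases Nat.eq_zero_or_pos k with rfl | hk
        · rw [h00]
        · have := hhalf k hk le_rfl; rw [h00] at this; exact this.le
  rw [SAW.Zd.mem_saws]
  refine ⟨hang_zero ω, ?_, ?_, ?_⟩
  · -- frozen from time `k + 1` on
    intro i hi
    obtain ⟨j, rfl⟩ : ∃ j, i = j + 1 := ⟨i - 1, by omega⟩
    rw [hang_succ, hang_succ, hend j (by omega)]
  · -- nearest-neighbour steps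
    intro i hi
    rcases Nat.eq_zero_or_pos i with rfl | hipos
    · rw [hang_zero, zero_add, hang_succ, h0, zdGraph_adj_iff]
      refine ⟨0, Or.inr ?_⟩
      funext t; fin_cases t <;> simp
    · obtain ⟨j, rfl⟩ : ∃ j, i = j + 1 := ⟨i - 1, by omega⟩
      have hstep := hadj j (by omega)
      rw [zdGraph_adj_iff] at hstep ⊢
      obtain ⟨l, hl | hl⟩ := hstep
      · have hc0 := congrFun hl 0
        have hc1 := congrFun hl 1
        fin_cases l
        · refine ⟨0, Or.inr (site_ext ?_ ?_)⟩
          · simp only [hang_succ_apply_zero, Pi.add_apply] at hc0 ⊢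
            simp at hc0 ⊢; omega
          · simp only [hang_succ_apply_one, Pi.add_apply] at hc1 ⊢
            simp at hc1 ⊢; omega
        · refine ⟨1, Or.inl (site_ext ?_ ?_)⟩
          · simp only [hang_succ_apply_zero, Pi.add_apply] at hc0 ⊢
            simp at hc0 ⊢; omega
          · simp only [hang_succ_apply_one, Pi.add_apply] at hc1 ⊢
            simp at hc1 ⊢; omega
      · have hc0 := congrFun hl 0
        have hc1 := congrFun hl 1
        fin_cases l
        · refine ⟨0, Or.inl (site_ext ?_ ?_)⟩
          · simp only [hang_succ_apply_zero, Pi.add_apply] at hc0 ⊢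
            simp at hc0 ⊢; omega
          · simp only [hang_succ_apply_one, Pi.add_apply] at hc1 ⊢
            simp at hc1 ⊢; omega
        · refine ⟨1, Or.inr (site_ext ?_ ?_)⟩
          · simp only [hang_succ_apply_zero, Pi.add_apply] at hc0 ⊢
            simp at hc0 ⊢; omega
          · simp only [hang_succ_apply_one, Pi.add_apply] at hc1 ⊢
            simp at hc1 ⊢; omega
  · -- self-avoidance
    intro i hi i' hi' heq
    simp only [Set.mem_setOf_eq] at hi hi'
    rcases Nat.eq_zero_or_pos i with rfl | hipos <;> rcases Nat.eq_zero_or_pos i' with rfl | hi'pos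
    · rfl
    · exfalso
      obtain ⟨j', rfl⟩ : ∃ j', i' = j' + 1 := ⟨i' - 1, by omega⟩
      have := congrFun heq 0
      rw [hang_zero, hang_succ_apply_zero] at this
      have h' := hnn j'
      simp at this; omega
    · exfalso
      obtain ⟨j, rfl⟩ : ∃ j, i = j + 1 := ⟨i - 1, by omega⟩
      have := congrFun heq 0
      rw [hang_zero, hang_succ_apply_zero] at this
      have h' := hnn j
      simp at this; omega
    · obtain ⟨j, rfl⟩ : ∃ j, i = j + 1 := ⟨i - 1, by omega⟩
      obtain ⟨j', rfl⟩ : ∃ j', i' = j' + 1 := ⟨i' - 1, by omega⟩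
      have e0 := congrFun heq 0
      have e1 := congrFun heq 1
      rw [hang_succ_apply_zero, hang_succ_apply_zero] at e0
      rw [hang_succ_apply_one, hang_succ_apply_one] at e1
      have hjj : ω j = ω j' := site_ext (by omega) e1
      have := hinj (show j ∈ {i | i ≤ k} by simp; omega) (show j' ∈ {i | i ≤ k} by simp; omega) hjj
      omega

/-- Coordinates and distance of the hung walk started at `(m, 0)`. [folklore] -/
theorem normSq_ax_add_hang_succ (m : ℤ) (ω : ℕ → Site 2) (j : ℕ) :
    ‖Site.toComplex (ax m + hang ω (j + 1))‖ ^ 2 =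
      ((m : ℝ) - 1 - (ω j 0 : ℝ)) ^ 2 + ((ω j 1 : ℝ)) ^ 2 := by
  rw [Complex.sq_norm, Complex.normSq_apply]
  have hre : (Site.toComplex (ax m + hang ω (j + 1))).re = (m : ℝ) - 1 - (ω j 0 : ℝ) := by
    simp [Site.toComplex, ax, hang_succ]; ring
  have him : (Site.toComplex (ax m + hang ω (j + 1))).im = (ω j 1 : ℝ) := by
    simp [Site.toComplex, ax, hang_succ]
  rw [hre, him]; ring

/-- **Key lower bound.** At `z = 0`, `R = m`, `r = m - 1`, `u = (m, 0)` (`m ≥ 3`), every half-plane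
walk of length `k ≤ K` (`K² ≤ m`), hung below the step `(m,0) → (m-1,0)`, is counted by the variant;
hence `x_c · H_K ≤ annMassNoAvoid 0 (m-1) m (m,0) (K+1)`. [folklore] -/
theorem annMassNoAvoid_ge (m K : ℕ) (hm : 3 ≤ m) (hK : K * K ≤ m) :
    SAW.criticalFugacity * halfPlanePartialSum K ≤
      annMassNoAvoid 0 ((m : ℝ) - 1) m (ax m) (K + 1) := by
  have hx : 0 ≤ SAW.criticalFugacity := criticalFugacity_pos.le
  have hmR : (3 : ℝ) ≤ m := by exact_mod_cast hm
  have hKR : (K : ℝ) * K ≤ m := by exact_mod_cast hK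
  unfold annMassNoAvoid halfPlanePartialSum
  rw [Finset.sum_range_succ' _ (K + 1), Finset.mul_sum]
  have htail : 0 ≤ ∑ _ω ∈ (SAW.Zd.saws 2 0).filter (fun ω =>
      (∀ i, 0 < i → i < 0 → dist (Site.toComplex (ax (m : ℤ) + ω i)) 0 < (m : ℝ)) ∧
        dist (Site.toComplex (ax (m : ℤ) + ω 0)) 0 ≤ (m : ℝ) - 1), SAW.criticalFugacity ^ 0 :=
    Finset.sum_nonneg fun _ _ => pow_nonneg hx 0
  refine le_trans ?_ (le_add_of_nonneg_right htail)
  refine Finset.sum_le_sum fun k hk => ?_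
  rw [Finset.mem_range] at hk
  have hkK : k ≤ K := by omega
  -- the counted family at length `k + 1` contains `hang '' (half-space walks of length k)`
  set A := (SAW.Zd.saws 2 (k + 1)).filter (fun ω =>
      (∀ i, 0 < i → i < k + 1 → dist (Site.toComplex (ax (m : ℤ) + ω i)) 0 < (m : ℝ)) ∧
        dist (Site.toComplex (ax (m : ℤ) + ω (k + 1))) 0 ≤ (m : ℝ) - 1) with hA
  have hsub : (SAW.Zd.halfSpaceWalks 2 k).image hang ⊆ A := by
    intro η hη
    rw [Finset.mem_image] at hη
    obtain ⟨ω, hω, rfl⟩ := hη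
    have hω' := hω
    rw [SAW.Zd.mem_halfSpaceWalks] at hω'
    obtain ⟨hsaw, hhalf⟩ := hω'
    obtain ⟨h0, hend, hadj, hinj⟩ := SAW.Zd.mem_saws.1 hsaw
    have h00 : ω 0 0 = 0 := by rw [h0]; rfl
    have habs := SAW.Zd.abs_apply_le_of_adj h0 hadj
    rw [hA, Finset.mem_filter]
    refine ⟨hang_mem_saws hω, fun i hi0 hik => ?_, ?_⟩
    · -- interior vertex `i = j + 1`, `j < k`: inside the open disc of radius `m`
      obtain ⟨j, rfl⟩ : ∃ j, i = j + 1 := ⟨i - 1, by omega⟩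
      have hjk : j ≤ k := by omega
      have ha0 : (0 : ℤ) ≤ ω j 0 := by
        rcases Nat.eq_zero_or_pos j with rfl | hj
        · rw [h00]
        · have := hhalf j hj hjk; rw [h00] at this; exact this.le
      have ha1 : ω j 0 ≤ j := (le_abs_self _).trans (habs j hjk 0)
      have hb : |ω j 1| ≤ j := habs j hjk 1
      have hb1 := (abs_le.1 hb)
      rw [dist_zero_right]
      have hm0 : (0 : ℝ) ≤ m := by linarith
      refine lt_of_pow_lt_pow_left₀ 2 hm0 ?_
      rw [normSq_ax_add_hang_succ]
      have ha0R : (0 : ℝ) ≤ ω j 0 := by exact_mod_cast ha0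
      have ha1R : (ω j 0 : ℝ) ≤ K := by
        have : (ω j 0 : ℝ) ≤ (j : ℝ) := by exact_mod_cast ha1
        have : (j : ℝ) ≤ K := by exact_mod_cast (hjk.trans hkK)
        linarith
      have hbR : -(K : ℝ) ≤ ω j 1 ∧ (ω j 1 : ℝ) ≤ K := by
        have hjK : (j : ℝ) ≤ K := by exact_mod_cast (hjk.trans hkK)
        constructor
        · have : (-(j : ℤ) : ℝ) ≤ (ω j 1 : ℝ) := by exact_mod_cast hb1.1
          push_cast at this; linarith
        · have : (ω j 1 : ℝ) ≤ (j : ℝ) := by exact_mod_cast hb1.2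
          linarith
      have hKm : (K : ℝ) ≤ m := by
        rcases Nat.eq_zero_or_pos K with rfl | hKp
        · simp
        · have : (1 : ℝ) ≤ K := by exact_mod_cast hKp
          nlinarith
      push_cast
      have P1 : (0 : ℝ) ≤ (ω j 0 : ℝ) * (2 * ((m : ℝ) - 1) - (ω j 0 : ℝ)) :=
        mul_nonneg ha0R (by linarith)
      have P2 : (0 : ℝ) ≤ ((K : ℝ) - (ω j 1 : ℝ)) * ((K : ℝ) + (ω j 1 : ℝ)) :=
        mul_nonneg (by linarith [hbR.2]) (by linarith [hbR.1])
      nlinarith [P1, P2]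
    · -- endpoint: inside the closed disc of radius `m - 1`
      rw [dist_zero_right]
      have hm1 : (0 : ℝ) ≤ (m : ℝ) - 1 := by linarith
      refine le_of_pow_le_pow_left₀ two_ne_zero hm1 ?_
      rw [normSq_ax_add_hang_succ]
      rcases Nat.eq_zero_or_pos k with rfl | hkpos
      · rw [h00]
        have : ω 0 1 = 0 := by rw [h0]; rfl
        rw [this]; push_cast
        nlinarith
      · have ha0 : (1 : ℤ) ≤ ω k 0 := by
          have := hhalf k hkpos le_rfl; rw [h00] at this; omega
        have ha1 : ω k 0 ≤ k := (le_abs_self _).trans (habs k le_rfl 0)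
        have hb1 := abs_le.1 (habs k le_rfl 1)
        have ha0R : (1 : ℝ) ≤ ω k 0 := by exact_mod_cast ha0
        have hkKR : (k : ℝ) ≤ K := by exact_mod_cast hkK
        have ha1R : (ω k 0 : ℝ) ≤ K := by
          have : (ω k 0 : ℝ) ≤ (k : ℝ) := by exact_mod_cast ha1
          linarith
        have hbR : -(K : ℝ) ≤ ω k 1 ∧ (ω k 1 : ℝ) ≤ K := by
          constructor
          · have : (-(k : ℤ) : ℝ) ≤ (ω k 1 : ℝ) := by exact_mod_cast hb1.1
            push_cast at this; linarith
          · have : (ω k 1 : ℝ) ≤ (k : ℝ) := by exact_mod_cast hb1.2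
            linarith
        have hKm : (K : ℝ) ≤ m := by
          have : (1 : ℝ) ≤ K := by
            have : 1 ≤ K := le_trans hkpos hkK
            exact_mod_cast this
          nlinarith
        push_cast
        have P1 : (0 : ℝ) ≤ ((ω k 0 : ℝ) - 1) * (2 * (m : ℝ) - 3 - (ω k 0 : ℝ)) :=
          mul_nonneg (by linarith) (by linarith)
        have P2 : (0 : ℝ) ≤ ((K : ℝ) - (ω k 1 : ℝ)) * ((K : ℝ) + (ω k 1 : ℝ)) :=
          mul_nonneg (by linarith [hbR.2]) (by linarith [hbR.1])
        nlinarith [P1, P2]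
  calc SAW.criticalFugacity * ((SAW.Zd.halfSpaceCount 2 k : ℝ) * SAW.criticalFugacity ^ k)
      = ((SAW.Zd.halfSpaceWalks 2 k).image hang).card * SAW.criticalFugacity ^ (k + 1) := by
        rw [Finset.card_image_of_injective _ hang_injective, SAW.Zd.halfSpaceCount, pow_succ]; ring
    _ ≤ A.card * SAW.criticalFugacity ^ (k + 1) := by
        have : (((SAW.Zd.halfSpaceWalks 2 k).image hang).card : ℝ) ≤ A.card := by
          exact_mod_cast Finset.card_le_card hsub
        exact mul_le_mul_of_nonneg_right this (pow_nonneg hx _)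
    _ = ∑ _ω ∈ A, SAW.criticalFugacity ^ (k + 1) := by rw [Finset.sum_const, nsmul_eq_mul]

/-- Any proof of the crux must use the inner-avoidance clause (interior vertices stay OUTSIDE the
target disc): without it, at `z = 0`, `R = m`, `r = m - 1`, `u = (m,0)` the counted mass exceeds
`x_c · H_{⌊√m⌋} → ∞` (`H(x_c) = ∞`, `halfPlanePartialSum_unbounded`), while `C (r/R)^θ ≤ C`. -/
theorem annularMassDecay_false_without_avoidInner : ¬ WithoutAvoidInner := by
  rintro ⟨θ, C, hθ, h⟩
  have hx : 0 < SAW.criticalFugacity := criticalFugacity_pos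
  have hbound : ∀ K : ℕ, SAW.criticalFugacity * halfPlanePartialSum K ≤ max C 0 := by
    intro K
    have hm : 3 ≤ max 3 (K * K) := le_max_left _ _
    have hK : K * K ≤ max 3 (K * K) := le_max_right _ _
    have h1 := annMassNoAvoid_ge (max 3 (K * K)) K hm hK
    set m : ℕ := max 3 (K * K) with hmdef
    have hmR : (3 : ℝ) ≤ m := by exact_mod_cast hm
    have hu : (m : ℝ) ≤ dist (Site.toComplex (ax (m : ℤ))) 0 := by
      rw [dist_ax_zero]; simp
    have h2 := h 0 ((m : ℝ) - 1) m (by linarith) (by linarith) (ax m) hu (K + 1)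
    have hq0 : (0 : ℝ) ≤ ((m : ℝ) - 1) / m := div_nonneg (by linarith) (by linarith)
    have hq1 : ((m : ℝ) - 1) / m ≤ 1 := (div_le_one (by linarith)).2 (by linarith)
    have h3 : (((m : ℝ) - 1) / m) ^ θ ≤ 1 := Real.rpow_le_one hq0 hq1 hθ.le
    have hnn : (0 : ℝ) ≤ (((m : ℝ) - 1) / m) ^ θ := Real.rpow_nonneg hq0 θ
    have h4 : C * (((m : ℝ) - 1) / m) ^ θ ≤ max C 0 :=
      calc C * (((m : ℝ) - 1) / m) ^ θ ≤ max C 0 * (((m : ℝ) - 1) / m) ^ θ :=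
            mul_le_mul_of_nonneg_right (le_max_left _ _) hnn
        _ ≤ max C 0 * 1 := mul_le_mul_of_nonneg_left h3 (le_max_right _ _)
        _ = max C 0 := mul_one _
    linarith
  obtain ⟨K, hK⟩ := halfPlanePartialSum_unbounded (max C 0 / SAW.criticalFugacity)
  have h5 := hbound K
  rw [div_lt_iff₀ hx] at hK
  linarith [mul_comm (halfPlanePartialSum K) SAW.criticalFugacity]

end

end Summit.CriticalPhenomena.SAWScalingLimit.Theorems.AnnularMassDecay.Negative
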